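import Summits.BirchSwinnertonDyer.BirchSwinnertonDyer.Theorems.CMKolyvaginAtInertTwoCMExactDescentAtTwo
import HarnessLib

/-!
# Route `CMKolyvaginAtInertTwo`, crux `CMExactDescentAtTwo` (item stmt-BirchSwinnertonDyer-22837) —
# the CM-FREE, RANK-ORDER-SYMMETRIC form of the exact `2`-adic Heegner descent, for reuse by the
# sibling line `GenusKolyvaginAtTwo` (item 22138 `ExactDescentAtTwo`, rank-`0` member) and re-typings

HONEST FRAMING (cell `bsd-print-cf2`, seat `bsd-line-cmk2-p1`): THEOREMS ONLY — no definition, no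
named fact, nothing asserted, nothing booked; BSD is not proved by this. The landed closer
`CMExactDescent.cmExactDescentAtTwo_of_facts` (`…CMExactDescentAtTwo.lean`, p581565) proves the
route decl `CMExactDescentAtTwo` verbatim modulo its four published inputs; its proof uses neither
`HasCM`, nor `CMInert W 2`, nor the optimality display of `Dt`, nor the ORDER of the analytic ranks
in the pair `{E, E^{(d_K)}}` (the exact Gross–Zagier identity over `K`,
`shaAnOverC_baseChange_eq_of_heegner`, needs only `ord_{s=1} L(E_K, s) = 1`; Milne's descent
`AdditivePotMult.bsdp_of_pPartOverC_baseChange` only `r_an ≤ 1` on both members). This file states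
that general form once (this module imports the route-bound closer file for its §1–§4 lemmas, which
the gate's dedup rule forbids re-declaring elsewhere; a `theses-cone` warning is accepted for it):

* `bsdp_two_of_card_sha_baseChange_eq_of_facts` — ANY globally minimal `W/ℚ` with `ρ̄_{E,2}` onto,
  `∏_ℓ c_ℓ` odd, `r_an(E) ≤ 1`; `K` imaginary quadratic, odd `d_K ≠ −3`, Heegner hypothesis for
  `N_E`; `Dt` with odd Manin constant; `d₁` of conductor `1` with `2^{M₀} ∥ P(1)` in `E(K[1])`;
  `ord_{s=1} L(E_K, s) = 1`; `#Ш(E_K)[2^∞] = 4^{M₀}`; `Wd` a globally minimal model of `E^{(d_K)}`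
  with `r_an ≤ 1` and `BSD(Wd, 2)` ⟹ **`BSD(W, 2)`**, modulo Gross–Zagier at `(N_E, W, K)`, GZK,
  modularity, Milne any-model;
* `…_rankOne` — `r_an(E) = 1`, `y_K` non-torsion (22837's shape without CM / optimality binders);
* `…_rankZero` — `r_an(E) = 0`, `r_an(Wd) = 1` (22138's shape, once its prover derives `r_an(Wd) = 1`
  from `#Sel₂(Wd) = 2`, `BSD(Wd,2)`, `y_K` non-torsion).

References: [GrossZagier1986] V.§2; [GrossLMS1991] §2 Conj. (2.2), §4; [McCallumLMS1991] §5
Lemma 5.1; [Milne1972ArithmeticAV] §1 Thm 1; [Miller2011LMS] Def. 1.1; cell DOSSIER §21.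
-/

set_option autoImplicit false
-- the Theorems namespace of this sub repeats the summit name by design (D-0017 nested layout)
set_option linter.dupNamespace false

noncomputable section

open scoped Classical

open WeierstrassCurve NumberField Literature.NumberTheory.EllipticCurves
  Literature.NumberTheory.EllipticCurves.ModularForms
  Literature.NumberTheory.EllipticCurves.Rank1Residual
  Literature.NumberTheory.EllipticCurves.Rank1Residual.Typed
  Literature.NumberTheory.EllipticCurves.KrizLi2019
  Summit.BirchSwinnertonDyer.Rank1Residual
  Summit.BirchSwinnertonDyer.Rank1Residual.AdditivePotMult

namespace Summit.BirchSwinnertonDyer.BirchSwinnertonDyer.Theorems.CMExactDescent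

variable (W : WeierstrassCurve ℚ) [W.IsElliptic] [W.IsGloballyMinimal] [NeZero (W.conductorNorm ℤ)]
  (K : Type) [Field K] [NumberField K]
  (Dt : ModularParametrizationData W (W.conductorNorm ℤ)) (β : ℤ) (ι : K →+* ℂ)
  (d₁ : KolyvaginHeegnerData Dt β ι 1)
  (Wd : WeierstrassCurve ℚ) [Wd.IsElliptic] [Wd.IsGloballyMinimal]

/-- **THE EXACT `2`-ADIC HEEGNER DESCENT, CM-free and symmetric in the rank order.** `W/ℚ` globally
minimal of conductor `N` with `ρ̄_{E,2}` onto (`hρ`), `∏_ℓ c_ℓ(E)` odd (`hT`), `r_an(E) ≤ 1` (`hr`);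
`K` imaginary quadratic with odd `d_K ≠ −3` (`hK`, `hodd`, `h3`: so `w_K = 2`) satisfying the Heegner
hypothesis for `N` (`hH`); `Dt` a parametrisation datum at level `N` with odd Manin constant (`hc`);
`d₁` a conductor-`1` Kolyvagin datum with `2^{M₀} ∥ P(1) = y_K` in `E(K[1])` (`hdiv`, `hndiv`);
`ord_{s=1} L(E_K, s) = 1` on the model `W ⊗ K` (`hrK`: the pair `{E, E^{(d_K)}}` has analytic ranks
`{0, 1}` in EITHER order); `#Ш(E_K/K)[2^∞] = 2^{2M₀}` (`hsha`); `Wd` a globally minimal model of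
`E^{(d_K)}` with `r_an(Wd) ≤ 1` and `BSD(Wd, 2)`. PUBLISHED inputs as binders: `hGZ` (Gross–Zagier at
`(N, W, K)`), `hGZK`, `hmod`, `hMilneC`. CONCLUSION: `BSD(W, 2)`. Proof: `P(1)` descends to `P₀ ∈ E(K)`
over the Heegner point of `Dt` (`exists_heegnerPoint_map_eq_derivedPoint_one`); `E(K[1])[2^M] = 0`
(`eq_zero_of_two_pow_smul_eq_zero_ringClassField`) transports `2^{M₀} ∥ P(1)` to `2^{M₀} ∥ P₀` in
`E(K)` (`Koly.pDiv_one_iff_exists_zsmul_eq`) and gives `ord₂ [E(K):ℤP₀] = M₀`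
(`Koly.padicValNat_index_zmultiples_eq_of_divisibility`); the exact identity
`#Ш_an(W ⊗ K) = 4I²/(c²·w_K²·(∏c_ℓ)²)` (`shaAnOverC_baseChange_eq_of_heegner`) then has
`ord₂ = 2M₀ = ord₂ #Ш(E_K/K)`, i.e. `MissingPPartOverCAt (W ⊗ K) 2`, and the model-free descent
`AdditivePotMult.bsdp_of_pPartOverC_baseChange` concludes.
[cite: GrossZagier1986, V.§2 (pp. 310–312)] [cite: McCallumLMS1991, §5 Lemma 5.1]
[cite: Milne1972ArithmeticAV, §1 Thm. 1] [cite: Miller2011LMS, Def. 1.1] -/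
theorem bsdp_two_of_card_sha_baseChange_eq_of_facts
    (hGZ : gross_zagier (W.conductorNorm ℤ) W K)
    (hGZK : rank_eq_analyticRank_of_analyticRank_le_one) (hmod : hasEntireLFunction_rat)
    (hMilneC : Milne1972.bsdQuotient_baseChange_quadratic_anyModel)
    (hρ : W.HasSurjectiveModNGaloisRep 2) (hT : Odd W.tamagawaProduct) (hr : W.analyticRank ≤ 1)
    (hK : IsImaginaryQuadratic K) (hodd : Odd (NumberField.discr K)) (h3 : NumberField.discr K ≠ -3)
    (hH : SatisfiesHeegnerHypothesis (W.conductorNorm ℤ) K) (hc : Odd Dt.c)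
    (hrK : (W.baseChange K).analyticRank = 1) {M₀ : ℕ}
    (hdiv : ∃ Q : (W.baseChange (ringClassField K ι 1)).toAffine.Point,
      ((2 ^ M₀ : ℕ) : ℤ) • Q = d₁.derivedPoint)
    (hndiv : ¬ ∃ Q : (W.baseChange (ringClassField K ι 1)).toAffine.Point,
      ((2 ^ (M₀ + 1) : ℕ) : ℤ) • Q = d₁.derivedPoint)
    (hsha : Nat.card (AddCommGroup.primaryComponent (W.baseChange K).sha 2) = 2 ^ (2 * M₀))
    (hWd : ∃ C : VariableChange ℚ, C • W.quadraticTwist (NumberField.discr K : ℚ) = Wd)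
    (hrd : Wd.analyticRank ≤ 1) (hBd : BSDp Wd 2) : BSDp W 2 := by
  haveI : Fact (Nat.Prime 2) := ⟨Nat.prime_two⟩
  haveI hEK : (W.baseChange K).IsElliptic := isElliptic_baseChange' W K
  have h2 : Module.finrank ℚ K = 2 := hK.1
  obtain ⟨-, hDlt⟩ := discr_emod_four_and_lt_of_odd hK hodd h3
  have hw2 : Units.torsionOrder K = 2 :=
    Literature.NumberTheory.QuadraticFields.Quadratic.torsionOrder_eq_two_of_discr_lt_neg_four h2 hDlt
  have hc0 : Dt.c ≠ 0 := by
    obtain ⟨k, hk⟩ := hc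
    omega
  -- the Heegner point `P₀ ∈ E(K)` below `P(1)`, for the datum `Dt`
  obtain ⟨P₀, Hd, hP₀, hP₀K⟩ := exists_heegnerPoint_map_eq_derivedPoint_one hK hH d₁
  -- the exact identity over `K`
  obtain ⟨hrkK, hShaK, hPinf, hshaC⟩ := shaAnOverC_baseChange_eq_of_heegner W K Dt Hd ι P₀ hGZ
    hGZK hmod hK hH hP₀ hc0 hrK
  haveI hfinK : Finite (W.baseChange K).sha := hShaK
  -- `ord₂ [E(K) : ℤP₀] = M₀`
  have htor1 : ∀ (M : ℕ) (R : (W.baseChange (ringClassField K ι 1)).toAffine.Point),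
      ((2 ^ M : ℕ) : ℤ) • R = 0 → R = 0 :=
    fun M R hR ↦ eq_zero_of_two_pow_smul_eq_zero_ringClassField W hK hodd hH hρ ι M R hR
  have hdivK : ∃ Q : (W.baseChange K).toAffine.Point, ((2 ^ M₀ : ℕ) : ℤ) • Q = P₀ :=
    (X11b.Three.Koly.pDiv_one_iff_exists_zsmul_eq hK d₁ P₀ hP₀K 2 M₀ (htor1 M₀)).mp hdiv
  have hndivK : ¬ ∃ Q : (W.baseChange K).toAffine.Point, ((2 ^ (M₀ + 1) : ℕ) : ℤ) • Q = P₀ :=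
    fun h ↦ hndiv ((X11b.Three.Koly.pDiv_one_iff_exists_zsmul_eq hK d₁ P₀ hP₀K 2 (M₀ + 1)
      (htor1 (M₀ + 1))).mpr h)
  have hiv : ∀ x : (W.baseChange K).toAffine.Point, 2 • x = 0 → x = 0 :=
    fun x hx ↦ eq_zero_of_two_smul_eq_zero_baseChange W hK hodd hH hρ x hx
  haveI : Finite (AddCommGroup.torsion (W.baseChange K).toAffine.Point) :=
    WeierstrassCurve.finite_torsion_point (W := W.baseChange K)
  obtain ⟨cc, Q, hcQ, hcker⟩ :=
    X11b.RankOne.exists_coord_of_mordellWeilRank_eq_one (W.baseChange K) hrkK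
  have hidx : padicValNat 2 (AddSubgroup.zmultiples P₀).index = M₀ :=
    X11b.Three.Koly.padicValNat_index_zmultiples_eq_of_divisibility (p := 2) cc Q hcQ hcker hiv P₀
      hdivK hndivK
  -- `ord₂ #Ш_an(W ⊗ K) = 2 M₀ = ord₂ #Ш(W ⊗ K)`
  set I := (AddSubgroup.zmultiples P₀).index with hI_def
  have hI0 : I ≠ 0 := fun hI ↦ by
    have hh := P2.torsionOrder_sq_mul_canonicalHeight_eq_index_sq_mul_regulator (W.baseChange K)
      hrkK P₀ hPinf
    rw [← hI_def, hI, Nat.cast_zero, zero_pow two_ne_zero, zero_mul, mul_eq_zero,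
      pow_eq_zero_iff two_ne_zero, Nat.cast_eq_zero] at hh
    exact hh.elim (W.baseChange K).torsionOrder_pos_holds.ne'
      (fun h0 ↦ hPinf ((Affine.Point.canonicalHeight_eq_zero_iff_holds P₀).mp h0))
  set q : ℚ := 4 * (I : ℚ) ^ 2 /
      ((Dt.c : ℚ) ^ 2 * (Units.torsionOrder K : ℚ) ^ 2 * ((W.tamagawaProduct : ℚ) ^ 2)) with hq_def
  have hcQ0 : (Dt.c : ℚ) ≠ 0 := by exact_mod_cast hc0
  have hcW0 : (W.tamagawaProduct : ℚ) ≠ 0 := by exact_mod_cast W.tamagawaProduct_pos_holds.ne'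
  have hIQ0 : (I : ℚ) ≠ 0 := by exact_mod_cast hI0
  have hq' : q = ((I : ℚ) / ((Dt.c : ℚ) * (W.tamagawaProduct : ℚ))) ^ 2 := by
    rw [hq_def, hw2]
    push_cast
    field_simp
    ring
  have hvc : padicValRat 2 (Dt.c : ℚ) = 0 := by
    rw [padicValRat.of_int, padicValInt.eq_zero_of_not_dvd (fun h2c ↦
      (Int.not_even_iff_odd.mpr hc) (even_iff_two_dvd.mpr h2c))]
    rfl
  have hvcW : padicValRat 2 (W.tamagawaProduct : ℚ) = 0 := by
    rw [padicValRat.of_nat, padicValNat.eq_zero_of_not_dvd hT.not_two_dvd_nat]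
    rfl
  have hval : padicValRat 2 q = 2 * (M₀ : ℤ) := by
    rw [hq', padicValRat.pow, padicValRat.div hIQ0 (mul_ne_zero hcQ0 hcW0),
      padicValRat.mul hcQ0 hcW0, hvc, hvcW, padicValRat.of_nat, hidx]
    push_cast
    ring
  have hshaV : padicValNat 2 (W.baseChange K).shaOrder = 2 * M₀ := by
    rw [X11b.Three.Koly.padicValNat_shaOrder_eq (W.baseChange K) 2, hsha, padicValNat.prime_pow]
  have hKin : MissingPPartOverCAt (W.baseChange K) 2 := ⟨q, hshaC, by rw [hval, hshaV]; push_cast; ring⟩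
  exact bsdp_of_pPartOverC_baseChange W 2 K Wd hGZK hmod hMilneC hr h2 hWd hrd hKin hBd

/-- **The rank-ONE member** (shape of `CMExactDescentAtTwo`, item 22837, without its CM / optimality
binders): `r_an(E) = 1` and `y_K = P(1)` of infinite order; then `L′(E/K,1) = L′(E,1)·L(E^{(d_K)},1) ≠ 0`
(Gross–Zagier at `P₀`), so `r_an(E^{(d_K)}) = 0`, `ord_{s=1} L(E_K,s) = 1`, and
`bsdp_two_of_card_sha_baseChange_eq_of_facts` applies. [cite: GrossZagier1986, V.§2 (p. 312)]
[cite: Miller2011LMS, Def. 1.1] -/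
theorem bsdp_two_of_card_sha_baseChange_eq_of_facts_rankOne
    (hGZ : gross_zagier (W.conductorNorm ℤ) W K)
    (hGZK : rank_eq_analyticRank_of_analyticRank_le_one) (hmod : hasEntireLFunction_rat)
    (hMilneC : Milne1972.bsdQuotient_baseChange_quadratic_anyModel)
    (hρ : W.HasSurjectiveModNGaloisRep 2) (hT : Odd W.tamagawaProduct) (hr : W.analyticRank = 1)
    (hK : IsImaginaryQuadratic K) (hodd : Odd (NumberField.discr K)) (h3 : NumberField.discr K ≠ -3)
    (hH : SatisfiesHeegnerHypothesis (W.conductorNorm ℤ) K) (hc : Odd Dt.c)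
    (hy : ¬ IsOfFinAddOrder d₁.derivedPoint) {M₀ : ℕ}
    (hdiv : ∃ Q : (W.baseChange (ringClassField K ι 1)).toAffine.Point,
      ((2 ^ M₀ : ℕ) : ℤ) • Q = d₁.derivedPoint)
    (hndiv : ¬ ∃ Q : (W.baseChange (ringClassField K ι 1)).toAffine.Point,
      ((2 ^ (M₀ + 1) : ℕ) : ℤ) • Q = d₁.derivedPoint)
    (hsha : Nat.card (AddCommGroup.primaryComponent (W.baseChange K).sha 2) = 2 ^ (2 * M₀))
    (hWd : ∃ C : VariableChange ℚ, C • W.quadraticTwist (NumberField.discr K : ℚ) = Wd)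
    (hBd : BSDp Wd 2) : BSDp W 2 := by
  have h2 : Module.finrank ℚ K = 2 := hK.1
  have hD0 : (NumberField.discr K : ℚ) ≠ 0 := by exact_mod_cast NumberField.discr_ne_zero K
  haveI hEt : (W.quadraticTwist (NumberField.discr K : ℚ)).IsElliptic :=
    W.isElliptic_quadraticTwist hD0
  obtain ⟨P₀, Hd, hP₀, hP₀K⟩ := exists_heegnerPoint_map_eq_derivedPoint_one hK hH d₁
  have hPinf : ¬ IsOfFinAddOrder P₀ := by
    intro hfin
    apply hy
    rw [← hP₀K]
    exact (WeierstrassCurve.Affine.Point.map (W' := W)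
      (algebraMap K (ringClassField K ι 1)).toRatAlgHom).isOfFinAddOrder hfin
  have hLK : LDerivEK W K ≠ 0 :=
    (lDerivEK_ne_zero_iff_not_isOfFinAddOrder W (W.conductorNorm ℤ) K hGZ hK hH
      ⟨Dt, Hd, ι, hP₀⟩).mpr hPinf
  have hL0 : W.entireLFunction 1 = 0 := entireLFunction_one_eq_zero_of_analyticRank_eq_one hr
  have hLt : (W.quadraticTwist (NumberField.discr K : ℚ)).entireLFunction 1 ≠ 0 := by
    intro h0
    apply hLK
    rw [lDerivEK_eq_deriv_mul W K hmod hL0, h0, mul_zero]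
  have hrt : (W.quadraticTwist (NumberField.discr K : ℚ)).analyticRank = 0 :=
    ((W.quadraticTwist _).analyticRank_eq_zero_iff_holds (hmod _)).mpr hLt
  have hrd : Wd.analyticRank = 0 := by
    obtain ⟨Cd, hCd⟩ := hWd
    rw [← hCd, analyticRank_smul, hrt]
  have hrK : (W.baseChange K).analyticRank = 1 :=
    (P2.analyticRank_baseChange_eq_one_iff W K hmod h2).mpr (Or.inl ⟨hr, hrt⟩)
  exact bsdp_two_of_card_sha_baseChange_eq_of_facts W K Dt β ι d₁ Wd hGZ hGZK hmod hMilneC hρ hT hr.le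
    hK hodd h3 hH hc hrK hdiv hndiv hsha hWd (by rw [hrd]; exact zero_le_one) hBd

/-- **The rank-ZERO member** (shape of `GenusKolyvaginAtTwo.ExactDescentAtTwo`, item 22138):
`r_an(E) = 0` and `r_an(Wd) = 1` for the globally minimal twin `Wd ≅ E^{(d_K)}`; then
`ord_{s=1} L(E_K,s) = 0 + 1 = 1` and `bsdp_two_of_card_sha_baseChange_eq_of_facts` applies. (The
22138 prover supplies `r_an(Wd) = 1` from that item's binders — `#Sel₂(Wd) = 2`, `BSD(Wd,2)`, `y_K`
non-torsion; not done here.) [cite: Miller2011LMS, Def. 1.1] -/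
theorem bsdp_two_of_card_sha_baseChange_eq_of_facts_rankZero
    (hGZ : gross_zagier (W.conductorNorm ℤ) W K)
    (hGZK : rank_eq_analyticRank_of_analyticRank_le_one) (hmod : hasEntireLFunction_rat)
    (hMilneC : Milne1972.bsdQuotient_baseChange_quadratic_anyModel)
    (hρ : W.HasSurjectiveModNGaloisRep 2) (hT : Odd W.tamagawaProduct) (hr : W.analyticRank = 0)
    (hK : IsImaginaryQuadratic K) (hodd : Odd (NumberField.discr K)) (h3 : NumberField.discr K ≠ -3)
    (hH : SatisfiesHeegnerHypothesis (W.conductorNorm ℤ) K) (hc : Odd Dt.c) {M₀ : ℕ}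
    (hdiv : ∃ Q : (W.baseChange (ringClassField K ι 1)).toAffine.Point,
      ((2 ^ M₀ : ℕ) : ℤ) • Q = d₁.derivedPoint)
    (hndiv : ¬ ∃ Q : (W.baseChange (ringClassField K ι 1)).toAffine.Point,
      ((2 ^ (M₀ + 1) : ℕ) : ℤ) • Q = d₁.derivedPoint)
    (hsha : Nat.card (AddCommGroup.primaryComponent (W.baseChange K).sha 2) = 2 ^ (2 * M₀))
    (hWd : ∃ C : VariableChange ℚ, C • W.quadraticTwist (NumberField.discr K : ℚ) = Wd)
    (hrd : Wd.analyticRank = 1) (hBd : BSDp Wd 2) : BSDp W 2 := by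
  have h2 : Module.finrank ℚ K = 2 := hK.1
  have hD0 : (NumberField.discr K : ℚ) ≠ 0 := by exact_mod_cast NumberField.discr_ne_zero K
  haveI hEt : (W.quadraticTwist (NumberField.discr K : ℚ)).IsElliptic :=
    W.isElliptic_quadraticTwist hD0
  have hrt : (W.quadraticTwist (NumberField.discr K : ℚ)).analyticRank = 1 := by
    obtain ⟨Cd, hCd⟩ := hWd
    have h := hrd
    rw [← hCd, analyticRank_smul] at h
    exact h
  have hrK : (W.baseChange K).analyticRank = 1 :=
    (P2.analyticRank_baseChange_eq_one_iff W K hmod h2).mpr (Or.inr ⟨hr, hrt⟩)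
  exact bsdp_two_of_card_sha_baseChange_eq_of_facts W K Dt β ι d₁ Wd hGZ hGZK hmod hMilneC hρ hT
    (by rw [hr]; exact zero_le_one) hK hodd h3 hH hc hrK hdiv hndiv hsha hWd hrd.le hBd

end Summit.BirchSwinnertonDyer.BirchSwinnertonDyer.Theorems.CMExactDescent

end
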